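import Summits.ResolutionOfSingularities.ResolutionOfSingularities.Theorems.UniversalCellsCampaignW82PrimeFieldTransferLinks
import Summits.ResolutionOfSingularities.ResolutionOfSingularities.Theorems.UniversalCellsCampaignW82FamilyResolutionInsepLinks
import Summits.ResolutionOfSingularities.ResolutionOfSingularities.Theorems.UniversalCellsPrimeFieldToPerfectSubalgebraInsepOneFibre
import Summits.ResolutionOfSingularities.ResolutionOfSingularities.Theorems.UniversalCellsCampaignW82PencilResolutionInsepOneFibre
import Mathlib.RingTheory.AlgebraicIndependent.TranscendenceBasis
import Mathlib.FieldTheory.RatFunc.AsPolynomial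
import HarnessLib

/-!
# [OURS · L1 W8.2 door 1] THE KERNEL `ClimbRatFuncPerf` AND THE CRUX `PrimeFieldToPerfect` AS «RESOLUTION IN
# PENCILS OVER PERFECT FIELDS, ONE CLOSED FIBRE, RADICIALLY» — by-name links (Theses-importing leaf)

Route `ResolutionOfSingularities/UniversalCells`, crux `PrimeFieldToPerfect` (stmt-15233), kernel of record
`CampaignW82.ClimbRatFuncPerf p` (the only open registered stub of both W8.2 crux skeletons: resolution over
a perfect `M` ⇒ resolution over every perfect purely inseparable extension `L` of `M(t)`). THIS FILE puts the
kernel and the crux slice in the PENCIL one-closed-fibre form (`CampaignW82.PencilResolutionInsepOneFibre`,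
p550061), using the door-1 E7 theorem over subalgebras
(`PrimeModelTransfer.hasResolution_of_forall_subalgebra_insepOneFibre`):

* `trdeg_le_one_of_isPurelyInseparable_ratFunc` — `trdeg_M L ≤ 1` for `L` purely inseparable over
  `RatFunc M` (`trdeg_add_eq` over `M[X]`, `Polynomial.trdeg_of_isDomain`, algebraic ⇒ `trdeg = 0`);
* `pencilResolutionInsepOneFibre_of_perfectRes` — `PerfectRes p →` the pencil form over every `k` of char `p`;
* `integralRes_of_pencilResolutionInsepOneFibre` — for PERFECT `M`: the pencil form over `M` ⇒ resolution
  over `M` itself (pencils over the point);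
* `climbRatFuncPerf_of_forall_pencilResolutionInsepOneFibre` — **`(∀ M` perfect of char `p`, Res(`M`) `→
  PencilResolutionInsepOneFibre p M) → ClimbRatFuncPerf p`**: the KERNEL follows from one-closed-fibre
  resolution of pencils;
* `integralPerfectRes_iff_forall_pencilResolutionInsepOneFibre` — resolution of integral varieties over all
  perfect fields of char `p` `↔ ∀ M` perfect of char `p`, `PencilResolutionInsepOneFibre p M`;
* `primeFieldTransferAt_iff_forall_pencilResolutionInsepOneFibre` — **the crux slice: `PrimeFieldTransferAt p
  ↔ (`resolution of integral schemes over `Spec (ZMod p)` `→ ∀ M` perfect of char `p`, Res(`M`) `→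
  PencilResolutionInsepOneFibre p M)`**; `primeFieldToPerfect_iff_forall_pencilResolutionInsepOneFibre` for
  the route declaration; closer shape `primeFieldToPerfect_of_forall_pencilResolutionInsepOneFibre`.

This is the tree's closed-fibre reformulation of the kernel (`Cruxes/PrimeFieldToPerfect/KERNEL-c3.md` §1,
(5.1)) BY NAME: «for every pencil of varieties over a perfect `M` (proper family over an affine `M`-curve with
integral radicial generic fibre): after a finite-type RADICIAL base change of the curve (a Frobenius level),
a proper modification of the family, FLAT along ONE closed fibre — a variety over a finite extension of `M` —
and an isomorphism over an open meeting it, has that fibre smooth». Grade: open-problem (the kernel); rungs as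
for the kernel (fibre dimension `≤ 1` unconditional, `≤ 3` ⇐ F-02; first open grade `4`); the negative census
of gens 3–5 (level unbounded, resolve-not-normalise, selection) applies verbatim — its witnesses are pencils.

[OURS · LADDER-RESOLUTION L1, slot W8.2 (prime-field / universality transfer), door 1 UniversalCells]
Theorems over the summit's own route and OURS names; NOT statements of, and attributing nothing to,
Hironaka's 2017 manuscript (the OURS `Prop`s replace the role of §17 ¶2, p.89 l.59–62). AI-written; weaker
than expert review. Theses-importing LEAF (imports the door-1 links leaf `…PrimeFieldTransferLinks` for
`primeFieldTransferAt_of_climbRatFuncPerf` / `climbRatFuncPerf_of_perfectRes` / `primeFieldToPerfect_iff`);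
nothing imports this file.
-/

noncomputable section

set_option linter.dupNamespace false -- mandated namespace of this single-conjunct summit

open CategoryTheory CategoryTheory.Limits AlgebraicGeometry TopologicalSpace
open Literature.AlgebraicGeometry.Resolution

namespace Summit.ResolutionOfSingularities.ResolutionOfSingularities.Theorems.CampaignW82

/-! ## Transcendence degree of the kernel's target fields -/

/-- **`trdeg_M L ≤ 1`** for a field `L` purely inseparable (hence algebraic) over `RatFunc M`, with the
`M`-algebra structure through `RatFunc M`: `trdeg_M L = trdeg_M M[X] + trdeg_{M[X]} L = 1 + 0` (Mathlib
`trdeg_add_eq`, `Polynomial.trdeg_of_isDomain`, `trdeg_eq_zero`). [folklore] -/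
theorem trdeg_le_one_of_isPurelyInseparable_ratFunc (M L : Type) [Field M] [Field L]
    [Algebra (RatFunc M) L] [IsPurelyInseparable (RatFunc M) L] [Algebra M L]
    [IsScalarTower M (RatFunc M) L] : Algebra.trdeg M L ≤ 1 := by
  letI : Algebra (Polynomial M) L :=
    ((algebraMap (RatFunc M) L).comp (algebraMap (Polynomial M) (RatFunc M))).toAlgebra
  haveI : IsScalarTower (Polynomial M) (RatFunc M) L := IsScalarTower.of_algebraMap_eq fun _ => rfl
  haveI : IsScalarTower M (Polynomial M) L := IsScalarTower.of_algebraMap_eq fun x => by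
    change algebraMap M L x = algebraMap (RatFunc M) L (algebraMap (Polynomial M) (RatFunc M)
      (algebraMap M (Polynomial M) x))
    rw [← IsScalarTower.algebraMap_apply M (Polynomial M) (RatFunc M),
      ← IsScalarTower.algebraMap_apply M (RatFunc M) L]
  haveI : FaithfulSMul (Polynomial M) L := (faithfulSMul_iff_algebraMap_injective _ _).mpr
    ((algebraMap (RatFunc M) L).injective.comp (IsFractionRing.injective (Polynomial M) (RatFunc M)))
  haveI : Algebra.IsAlgebraic (Polynomial M) (RatFunc M) :=
    IsLocalization.isAlgebraic (RatFunc M) (nonZeroDivisors (Polynomial M))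
  haveI : Algebra.IsAlgebraic (RatFunc M) L := IsPurelyInseparable.isAlgebraic (RatFunc M) L
  haveI : Algebra.IsAlgebraic (Polynomial M) L := Algebra.IsAlgebraic.trans (Polynomial M) (RatFunc M) L
  rw [← trdeg_add_eq M (Polynomial M) (A := L), Polynomial.trdeg_of_isDomain, trdeg_eq_zero, add_zero]

/-! ## The pencil form from resolution over perfect fields, and back over the point -/

/-- **`PerfectRes p → PencilResolutionInsepOneFibre p k`** for every field `k` of characteristic `p`
(one-fibre radicial form p549450/H4 ⇒ its pencil restriction). [folklore] -/
theorem pencilResolutionInsepOneFibre_of_integralPerfectRes (p : ℕ) [Fact p.Prime]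
    (hperf : ∀ (K : Type) [Field K] [CharP K p] [PerfectField K] (X : Scheme.{0})
      (f : X ⟶ Spec (.of K)), IsSeparated f → LocallyOfFiniteType f → QuasiCompact f → IsIntegral X →
        Scheme.HasResolution X)
    (k : Type) [Field k] [CharP k p] : PencilResolutionInsepOneFibre p k :=
  pencilResolutionInsepOneFibre_of_familyResolutionInsepOneFibre
    (PrimeModelTransfer.familyResolutionInsepOneFibre_of_smoothFamilyResolutionInsep p k
      (PrimeModelTransfer.smoothFamilyResolutionInsep_of_integralPerfectRes p hperf k))

/-- **Pencils over the point already contain resolution over a PERFECT `M`.** For `M` perfect of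
characteristic `p`, `PencilResolutionInsepOneFibre p M` implies that every integral separated `M`-scheme of
finite type has a resolution (`hasResolution_of_forall_subalgebra_insepOneFibre` with `k = K = M`: the
finitely generated `M`-subalgebras of `M` have transcendence degree `0 ≤ 1`). [folklore] -/
theorem integralRes_of_pencilResolutionInsepOneFibre (p : ℕ) [Fact p.Prime] (M : Type) [Field M]
    [CharP M p] [PerfectField M] (h : PencilResolutionInsepOneFibre p M) :
    ∀ (X : Scheme.{0}) (f : X ⟶ Spec (.of M)), IsSeparated f → LocallyOfFiniteType f →
      QuasiCompact f → IsIntegral X → Scheme.HasResolution X := by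
  intro X f hs hl hq hX
  haveI := hs; haveI := hl; haveI := hq; haveI := hX
  refine PrimeModelTransfer.hasResolution_of_forall_subalgebra_insepOneFibre p M M
    (fun A _ _ _ ψ hψ hA 𝒳 g hg L _ _ _ hAL hrad hint => h A hA ?_ 𝒳 g hg ⟨L, _, ‹_›, _, hAL, hrad, hint⟩) X f
  calc Algebra.trdeg M A ≤ Algebra.trdeg M M := trdeg_le_of_injective ψ hψ
    _ = 0 := trdeg_eq_zero
    _ ≤ 1 := zero_le_one

/-! ## The kernel from pencils -/

/-- **One-closed-fibre resolution of pencils gives the kernel `ClimbRatFuncPerf p`.** If over every perfect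
`M` of characteristic `p` with resolution, `PencilResolutionInsepOneFibre p M` holds, then resolution climbs
from `M` to every perfect purely inseparable extension `L` of `RatFunc M`: an `L`-variety spreads over a
finitely generated `M`-subalgebra `R ⊆ L` with `trdeg_M R ≤ trdeg_M L ≤ 1`
(`trdeg_le_one_of_isPurelyInseparable_ratFunc`), whose proper family is a pencil;
`PrimeModelTransfer.hasResolution_of_forall_subalgebra_insepOneFibre` (E7, `L` perfect) concludes.
[folklore] -/
theorem climbRatFuncPerf_of_forall_pencilResolutionInsepOneFibre {p : ℕ} [Fact p.Prime]
    (h : ∀ (M : Type) [Field M] [CharP M p] [PerfectField M],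
      (∀ (X : Scheme.{0}) (f : X ⟶ Spec (.of M)), IsSeparated f → LocallyOfFiniteType f →
          QuasiCompact f → IsIntegral X → Scheme.HasResolution X) →
        PencilResolutionInsepOneFibre p M) :
    ClimbRatFuncPerf p := by
  intro M _ _ _ hM L _ _ _ _ X f hs hl hq hX
  haveI := hs; haveI := hl; haveI := hq; haveI := hX
  letI : Algebra M L := ((algebraMap (RatFunc M) L).comp (algebraMap M (RatFunc M))).toAlgebra
  haveI : IsScalarTower M (RatFunc M) L := IsScalarTower.of_algebraMap_eq fun _ => rfl
  haveI : CharP L p := charP_of_injective_algebraMap (algebraMap M L).injective p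
  have hL : Algebra.trdeg M L ≤ 1 := trdeg_le_one_of_isPurelyInseparable_ratFunc M L
  exact PrimeModelTransfer.hasResolution_of_forall_subalgebra_insepOneFibre p M L
    (fun A _ _ _ ψ hψ hA 𝒳 g hg L' _ _ _ hAL hrad hint =>
      h M hM A hA (le_trans (trdeg_le_of_injective ψ hψ) hL) 𝒳 g hg ⟨L', _, ‹_›, _, hAL, hrad, hint⟩) X f

/-- **Resolution of integral varieties over all perfect fields of characteristic `p` ⟺ the pencil form over
every perfect field of characteristic `p`.** (→ `pencilResolutionInsepOneFibre_of_integralPerfectRes`;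
← `integralRes_of_pencilResolutionInsepOneFibre` at each perfect `M`.) [folklore] -/
theorem integralPerfectRes_iff_forall_pencilResolutionInsepOneFibre (p : ℕ) [Fact p.Prime] :
    (∀ (K : Type) [Field K] [CharP K p] [PerfectField K] (X : Scheme.{0}) (f : X ⟶ Spec (.of K)),
        IsSeparated f → LocallyOfFiniteType f → QuasiCompact f → IsIntegral X → Scheme.HasResolution X) ↔
      ∀ (M : Type) [Field M] [CharP M p] [PerfectField M], PencilResolutionInsepOneFibre p M :=
  ⟨fun h M _ _ _ => pencilResolutionInsepOneFibre_of_integralPerfectRes p h M,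
    fun h K _ _ _ X f hs hl hq hX => integralRes_of_pencilResolutionInsepOneFibre p K (h K) X f hs hl hq hX⟩

/-- `PerfectRes p` (reduced wording) `↔` the pencil form over every perfect field of characteristic `p`.
[folklore] -/
theorem perfectRes_iff_forall_pencilResolutionInsepOneFibre (p : ℕ) [Fact p.Prime] :
    Summit.ResolutionOfSingularities.ResolutionOfSingularities.Theorems.PerfectRes p ↔
      ∀ (M : Type) [Field M] [CharP M p] [PerfectField M], PencilResolutionInsepOneFibre p M := by
  rw [← integralPerfectRes_iff_forall_pencilResolutionInsepOneFibre]
  constructor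
  · intro h K _ _ _ X f hs hl hq hX
    haveI := hX
    exact h K X f hs hl hq inferInstance
  · intro h K _ _ _ X f hs hl hq hX
    haveI := hs; haveI := hl; haveI := hq; haveI := hX
    exact hasResolution_of_isReduced_of_forall_isIntegral K (fun Y g hs' hl' hq' hY => h K Y g hs' hl' hq' hY)
      X f

/-! ## The crux slice by name -/

/-- **THE CRUX SLICE IS RESOLUTION IN PENCILS OVER PERFECT FIELDS, ONE CLOSED FIBRE, BY NAME.**
`PrimeFieldTransferAt p ↔ (`resolution of integral schemes over `Spec (ZMod p)` `→ ∀ M` perfect of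
characteristic `p`, Res(`M`) `→ PencilResolutionInsepOneFibre p M)`. «→»: the slice gives `PerfectRes p`,
whence the pencil form. «←»: `climbRatFuncPerf_of_forall_pencilResolutionInsepOneFibre` and
`primeFieldTransferAt_of_climbRatFuncPerf` (p475515). [folklore] -/
theorem primeFieldTransferAt_iff_forall_pencilResolutionInsepOneFibre (p : ℕ) [Fact p.Prime] :
    PrimeFieldTransferAt p ↔
      ((∀ (X : Scheme.{0}) (f : X ⟶ Spec (.of (ZMod p))),
          IsSeparated f → LocallyOfFiniteType f → QuasiCompact f → IsIntegral X → Scheme.HasResolution X) →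
        ∀ (M : Type) [Field M] [CharP M p] [PerfectField M],
          (∀ (X : Scheme.{0}) (f : X ⟶ Spec (.of M)), IsSeparated f → LocallyOfFiniteType f →
              QuasiCompact f → IsIntegral X → Scheme.HasResolution X) →
            PencilResolutionInsepOneFibre p M) := by
  constructor
  · intro hT h0 M _ _ _ _
    have hP : Summit.ResolutionOfSingularities.ResolutionOfSingularities.Theorems.PerfectRes p := hT h0
    exact (perfectRes_iff_forall_pencilResolutionInsepOneFibre p).mp hP M
  · intro h h0
    exact primeFieldTransferAt_of_climbRatFuncPerf p
      (climbRatFuncPerf_of_forall_pencilResolutionInsepOneFibre (h h0)) h0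

/-- **For the route declaration.** `Theses.UniversalCells.PrimeFieldToPerfect ↔ ∀ p [Fact p.Prime]`,
resolution over `Spec (ZMod p)` implies: over every perfect `M` of characteristic `p` with resolution, PENCILS
are resolvable in the one-closed-fibre radicial sense. [folklore] -/
theorem primeFieldToPerfect_iff_forall_pencilResolutionInsepOneFibre :
    Summit.ResolutionOfSingularities.ResolutionOfSingularities.Theses.UniversalCells.PrimeFieldToPerfect ↔
      ∀ (p : ℕ) [Fact p.Prime],
        (∀ (X : Scheme.{0}) (f : X ⟶ Spec (.of (ZMod p))),
            IsSeparated f → LocallyOfFiniteType f → QuasiCompact f → IsIntegral X →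
              Scheme.HasResolution X) →
          ∀ (M : Type) [Field M] [CharP M p] [PerfectField M],
            (∀ (X : Scheme.{0}) (f : X ⟶ Spec (.of M)), IsSeparated f → LocallyOfFiniteType f →
                QuasiCompact f → IsIntegral X → Scheme.HasResolution X) →
              PencilResolutionInsepOneFibre p M := by
  rw [primeFieldToPerfect_iff]
  constructor
  · intro h p hp
    exact (primeFieldTransferAt_iff_forall_pencilResolutionInsepOneFibre p).mp (h p hp.out)
  · intro h p hp
    haveI : Fact p.Prime := ⟨hp⟩
    exact (primeFieldTransferAt_iff_forall_pencilResolutionInsepOneFibre p).mpr (h p)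

/-- **Closer shape.** [folklore] -/
theorem primeFieldToPerfect_of_forall_pencilResolutionInsepOneFibre
    (h : ∀ (p : ℕ) [Fact p.Prime],
      (∀ (X : Scheme.{0}) (f : X ⟶ Spec (.of (ZMod p))),
          IsSeparated f → LocallyOfFiniteType f → QuasiCompact f → IsIntegral X → Scheme.HasResolution X) →
        ∀ (M : Type) [Field M] [CharP M p] [PerfectField M],
          (∀ (X : Scheme.{0}) (f : X ⟶ Spec (.of M)), IsSeparated f → LocallyOfFiniteType f →
              QuasiCompact f → IsIntegral X → Scheme.HasResolution X) →
            PencilResolutionInsepOneFibre p M) :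
    Summit.ResolutionOfSingularities.ResolutionOfSingularities.Theses.UniversalCells.PrimeFieldToPerfect :=
  primeFieldToPerfect_iff_forall_pencilResolutionInsepOneFibre.mpr h

end Summit.ResolutionOfSingularities.ResolutionOfSingularities.Theorems.CampaignW82

end
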